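import Mathlib
import HarnessLib
import Summits.ValiantsHypothesis.ValiantsHypothesis.Theses.MonotoneRestoration
import Summits.ValiantsHypothesis.ValiantsHypothesis.Theorems.MonotoneRestorationMultilinearRestorationQPValues

/-!
# The multilinear rung sits below the crux: `MonotoneRestorationQP → MultilinearRestorationQP`

Helper file (`--supports stmt-ValiantsHypothesis-17621`) for the support item
`Summit.ValiantsHypothesis.ValiantsHypothesis.Theses.MonotoneRestoration.MultilinearRestorationQP`
of route `MonotoneRestoration`.  The route files the rung as "a special case of the crux"
`MonotoneRestorationQP`; `multilinearRestorationQP_of_monotoneRestorationQP` is the formal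
certificate of that sentence: a family with `smCircuitSize (f n) ≤ (n+2)^c` over `ℝ≥0` has
monotone `complexity (f n) ≤ (n+2)^c` and, being multilinear in the `n·n` variables `x_ij`
(`Theorems/MonotoneRestorationMultilinearRestorationQPValues.lean`), total degree
`≤ n·n ≤ (n+2)^2`, so the crux applies with exponent `max c 2`.

Sources: RazYehudayoff2008 §2 (the model), Burgisser2000 Def. 2.1. No named fact is used.
-/

-- single-problem summit: `Summit.ValiantsHypothesis.ValiantsHypothesis.…` is the namespace by design (D-0017)
set_option linter.dupNamespace false

noncomputable section

namespace Summit.ValiantsHypothesis.ValiantsHypothesis.Theorems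

open Literature.Computability.AlgebraicComplexity MvPolynomial
open Summit.ValiantsHypothesis.ValiantsHypothesis.Theses.MonotoneRestoration


/-- **The multilinear rung is a special case of the crux**:
`MonotoneRestorationQP → MultilinearRestorationQP`.  A family with `smCircuitSize (f n) ≤ (n+2)^c`
over `ℝ≥0` has monotone `complexity (f n) ≤ (n+2)^c` and, being multilinear in the `n·n`
variables `x_ij`, total degree `≤ n·n ≤ (n+2)^2`; so the crux applies with exponent `max c 2`.
[cite: RazYehudayoff2008, §2] -/
theorem multilinearRestorationQP_of_monotoneRestorationQP (hcrux : MonotoneRestorationQP) :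
    MultilinearRestorationQP := by
  intro f hsym hsm
  obtain ⟨c, hc⟩ := hsm
  refine hcrux f hsym ⟨max c 2, fun n => ⟨?_, ?_⟩⟩
  · calc (f n).totalDegree ≤ Fintype.card (Fin n × Fin n) :=
          MultilinearRung.totalDegree_le_of_smCircuitSize_le (hc n)
      _ = n * n := by simp
      _ ≤ (n + 2) ^ 2 := by nlinarith
      _ ≤ (n + 2) ^ max c 2 := Nat.pow_le_pow_right (by omega) (le_max_right _ _)
  · exact (MultilinearRung.complexity_le_of_smCircuitSize_le (hc n)).trans
      (Nat.pow_le_pow_right (by omega) (le_max_left _ _))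

end Summit.ValiantsHypothesis.ValiantsHypothesis.Theorems

end
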